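import Summits.CriticalPhenomena.CardyFormulaZ2.Theorems.CardyFlipRussoVoronoiHubFromSmirnovOneArmDefs
import Summits.CriticalPhenomena.CardyFormulaZ2.Theorems.CardyFlipRussoVoronoiHubFromSmirnovMeasurableGraphCross
import Summits.CriticalPhenomena.CardyFormulaZ2.Theorems.CardyFlipRussoVoronoiHubFromSmirnovChainBlackPath
import Summits.CriticalPhenomena.CardyFormulaZ2.Theorems.CardyFlipRussoVoronoiHubFromSmirnovUnionLaw
import Summits.CriticalPhenomena.CardyFormulaZ2.Theorems.CardyFlipRussoVoronoiHubFromSmirnovInsertMono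
import Summits.CriticalPhenomena.CardyFormulaZ2.Theorems.CardyFlipRussoVoronoiHubFromSmirnovGraphRestrict
import Literature.Probability.Percolation.VoronoiArmEstimates
import Mathlib.Topology.MetricSpace.Thickening
import HarnessLib

/-!
# Stubs `armLoc_eq_preimage_graphCross`, `armLoc_bound` of line `moebius-exact-delaunay-dilation-ward`
# (crux `VoronoiHubFromSmirnov`, stmt-CriticalPhenomena-6433)

THE LOCALISED CHAIN-ARM EVENT AND ITS ONE-ARM BOUND.  The chain-arm event of the one-arm route
(`ChainArm`, third definitions module), read with the Euclidean adjacency of the window `D`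
(`adjEuc D`) and black chain nuclei in `D' ⊆ D`, is

* `armLoc_eq_preimage_graphCross` — the preimage, under restriction of both colours to `D`, of a
  graph crossing event `graphCross` (carrier `K ∩ δ • D'`, attachments the closed disc
  `B̄(δ z, δ r₁)` and the complement of the open disc `B(δ z, δ r₂)`); in particular it is
  measurable for measurable data (`measurableSet_armLoc`, by the landed `measurableSet_graphCross`);
* `armLoc_bound` — of probability at most `C (r₁ / r₂) ^ η` plus the probability of an `ℓ/2`-void
  of black nuclei over `cthickening (2ℓ) D'`, under the homogeneous two-colour law `lawBW volume`,
  GIVEN Tassion's annealed one-arm bound `VoronoiAnnealedOneArm` (named Literature fact, taken as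
  a hypothesis), whenever `cthickening (3ℓ) D' ⊆ D`, `1 ≤ r₁ ≤ r₂`.

Proof of the bound.  Off the void event and off the null event "no white nucleus at all", the
landed `chain_blackPath` (window nuclei `c.i ∩ D`, region `A = cthickening (2ℓ) D'`, radius `ℓ`:
chain points lie in `D'`, so `closedBall (p i) (2ℓ) ⊆ A`; a black nucleus within `ℓ/2` of a point
of `A` lies in `cthickening (3ℓ) D' ⊆ D`; a white nucleus outside `D` is at distance `> ℓ` from
`A`) turns the Delaunay chain into a path inside `blackRegion c.1 c.2` from `p₀` (`dist p₀ z ≤ r₁`)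
to `p_N` (`dist p_N z ≥ r₂`) — Tassion's event at mesh `1`, radii `r₁ ≤ r₂`, whose probability
is `≤ C₀ (r₁/r₂)^η` for `PB = PW = poissonLaw volume` (a Poisson law of Lebesgue intensity,
`isPoissonPointProcess_poissonLaw_volume`).  The empty white configuration has no point in
`ball 0 n`, an event of probability `exp (-π n²) → 0` (`lawBW_real_countSnd_eq_zero`).
Outer-measure monotonicity and subadditivity finish (no measurability is used in the bound).

Sources: V. Tassion, Ann. Probab. 44 (2016) Thm 3 (2) (the named fact); B. Bollobás, O. Riordan,
*Percolation* (2006) Ch. 8 §8.2 (Delaunay-chain formulation).  No new definitions.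
-/

noncomputable section

namespace Summit.CriticalPhenomena.CardyFormulaZ2.Cruxes.VoronoiHubFromSmirnov.MoebiusExactDelaunayDilationWard

open scoped Topology ENNReal
open Filter Set MeasureTheory Metric
open Literature.Analysis.FunctionSpaces
open Literature.Probability.LatticeModels (IsDelaunayPair)
open Literature.Probability.Percolation (blackRegion)

/-! ### Elementary helpers -/

/-- Dilation by `δ > 0` multiplies distances by `δ`. [folklore] -/
theorem al_dist_mul {δ : ℝ} (hδ : 0 < δ) (a b : ℂ) :
    dist ((δ : ℂ) * a) ((δ : ℂ) * b) = δ * dist a b := by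
  rw [dist_eq_norm, dist_eq_norm, ← mul_sub, norm_mul, Complex.norm_real, Real.norm_eq_abs,
    abs_of_pos hδ]

/-- A point within `ℓ` of the `2ℓ`-thickening of `D'` lies in the `3ℓ`-thickening. [folklore] -/
theorem al_mem_cthickening_three {D' : Set ℂ} {x y : ℂ} {ℓ : ℝ} (hℓ : 0 ≤ ℓ)
    (hx : x ∈ cthickening (2 * ℓ) D') (hyx : dist y x ≤ ℓ) : y ∈ cthickening (3 * ℓ) D' := by
  have h1 : y ∈ cthickening ℓ (cthickening (2 * ℓ) D') :=
    closedBall_subset_cthickening hx ℓ (mem_closedBall.2 hyx)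
  have h2 := cthickening_cthickening_subset hℓ (by linarith) D' h1
  rwa [show ℓ + 2 * ℓ = 3 * ℓ by ring] at h2

/-- If `A ⊆ P ∪ V ∪ E` with `E` null and `μ(P) ≤ a`, then `μ(A) ≤ a + μ(V)` (outer-measure
monotonicity and subadditivity; no measurability). [folklore] -/
theorem al_measureReal_le_of_subset_union₃ {α : Type*} [MeasurableSpace α] {μ : Measure α}
    [IsFiniteMeasure μ] {A P V E : Set α} {a : ℝ} (h : A ⊆ P ∪ V ∪ E) (hE : μ.real E = 0)
    (hP : μ.real P ≤ a) : μ.real A ≤ a + μ.real V :=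
  calc μ.real A ≤ μ.real (P ∪ V ∪ E) := measureReal_mono h (measure_ne_top μ _)
    _ ≤ μ.real (P ∪ V) + μ.real E := measureReal_union_le _ _
    _ ≤ μ.real P + μ.real V + μ.real E := by
        gcongr
        exact measureReal_union_le _ _
    _ ≤ a + μ.real V := by
        rw [hE, add_zero]
        gcongr

/-! ### The white configuration is non-empty almost surely -/

/-- Under `lawBW volume` the WHITE configuration is non-empty almost surely: the empty
configuration has no point in `ball 0 n`, an event of probability `exp (-π n²) → 0` (void
probability `lawBW_real_countSnd_eq_zero`, `im_le_zero_of_forall_le_exp`). [folklore] -/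
theorem al_lawBW_real_snd_not_nonempty :
    (lawBW (volume : Measure ℂ)).real
      {c : PointConfig ℂ × PointConfig ℂ | ¬ (c.2 : Set ℂ).Nonempty} = 0 := by
  haveI := isProbabilityMeasure_lawBW_volume
  refine le_antisymm (im_le_zero_of_forall_le_exp Real.pi_pos fun n => ?_) measureReal_nonneg
  have h := lawBW_real_countSnd_eq_zero isPoissonPointProcess_poissonLaw_volume
    (measurableSet_ball : MeasurableSet (ball (0 : ℂ) n)) measure_ball_lt_top.ne
  rw [volume_real_complex_ball _ (Nat.cast_nonneg n)] at h
  rw [← h]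
  exact measureReal_mono (fun c hc => im_count_eq_zero_of_not_nonempty hc _) (measure_ne_top _ _)

/-! ### The localised arm event is a preimage of a graph crossing event -/

/-- **The localised chain-arm event is a restricted graph crossing event.**  For `0 < δ` and
`D' ⊆ D`, a configuration pair `c` has an `adjEuc D c`-chain arm around `z` between radii `r₁`,
`r₂` with black chain nuclei in `c.1 ∩ D'` iff the pair restricted to `D` lies in the graph
crossing event with carrier `K ∩ δ • D'`, source `closedBall (δ z) (δ r₁)` and target
`(ball (δ z) (δ r₂))ᶜ`: the adjacency sets agree literally (`(c.i|D : Set ℂ) = c.i ∩ D`), the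
nucleus conditions by injectivity of `x ↦ δ x`, the attachments by `dist (δ a) (δ b) = δ dist a b`.
[folklore] -/
theorem armLoc_eq_preimage_graphCross : ∀ (D D' K : Set ℂ) (z : ℂ) (r₁ r₂ δ : ℝ), 0 < δ → D' ⊆ D → {c : Literature.Analysis.FunctionSpaces.PointConfig ℂ × Literature.Analysis.FunctionSpaces.PointConfig ℂ | ChainArm (adjEuc D c) z r₁ r₂ K δ ((c.1 : Set ℂ) ∩ D')} = (fun c : Literature.Analysis.FunctionSpaces.PointConfig ℂ × Literature.Analysis.FunctionSpaces.PointConfig ℂ => (Literature.Analysis.FunctionSpaces.PointConfig.restrict D c.1, Literature.Analysis.FunctionSpaces.PointConfig.restrict D c.2)) ⁻¹' graphCross (K ∩ (fun x : ℂ => (δ : ℂ) * x) '' D') (Metric.closedBall ((δ : ℂ) * z) (δ * r₁)) (Metric.ball ((δ : ℂ) * z) (δ * r₂))ᶜ δ := by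
  intro D D' K z r₁ r₂ δ hδ hD'
  have hδ0 : (δ : ℂ) ≠ 0 := Complex.ofReal_ne_zero.2 hδ.ne'
  ext c
  rw [mem_preimage, mem_setOf_eq, mem_graphCross_iff_adjCross]
  constructor
  · rintro ⟨N, p, hp, hK, h0, hN, hE⟩
    refine ⟨N, p, fun i => gr_mem_restrict_iff.2 ⟨(hp i).1, hD' (hp i).2⟩,
      fun i => ⟨hK i, p i, (hp i).2, rfl⟩, ?_, ?_, ?_⟩
    · rw [mem_closedBall, al_dist_mul hδ]
      exact (mul_le_mul_iff_right₀ hδ).2 h0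
    · rw [mem_compl_iff, mem_ball, not_lt, al_dist_mul hδ]
      exact (mul_le_mul_iff_right₀ hδ).2 hN
    · intro i
      simpa only [adjEuc, PointConfig.coe_eq_carrier, PointConfig.carrier_restrict] using hE i
  · rintro ⟨N, p, hp, hK, h0, hN, hE⟩
    have hpD' : ∀ i, p i ∈ D' := fun i => by
      obtain ⟨x, hx, hxe⟩ := (hK i).2
      rw [← mul_left_cancel₀ hδ0 hxe]
      exact hx
    refine ⟨N, p, fun i => ⟨(gr_mem_restrict_iff.1 (hp i)).1, hpD' i⟩, fun i => (hK i).1,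
      ?_, ?_, ?_⟩
    · rw [mem_closedBall, al_dist_mul hδ] at h0
      exact (mul_le_mul_iff_right₀ hδ).1 h0
    · rw [mem_compl_iff, mem_ball, not_lt, al_dist_mul hδ] at hN
      exact (mul_le_mul_iff_right₀ hδ).1 hN
    · intro i
      simpa only [adjEuc, PointConfig.coe_eq_carrier, PointConfig.carrier_restrict] using hE i

/-- **Measurability of the localised chain-arm event** for measurable `D ⊇ D'`, `K` and `0 < δ`:
it is the preimage of a measurable graph crossing event (`measurableSet_graphCross`) under the
measurable restriction of both colours to `D`. [folklore] -/
theorem measurableSet_armLoc {D D' K : Set ℂ} (hD : MeasurableSet D) (hD' : MeasurableSet D')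
    (hK : MeasurableSet K) (z : ℂ) (r₁ r₂ : ℝ) {δ : ℝ} (hδ : 0 < δ) (hD'D : D' ⊆ D) :
    MeasurableSet {c : PointConfig ℂ × PointConfig ℂ |
      ChainArm (adjEuc D c) z r₁ r₂ K δ ((c.1 : Set ℂ) ∩ D')} := by
  have hδ0 : (δ : ℂ) ≠ 0 := Complex.ofReal_ne_zero.2 hδ.ne'
  rw [armLoc_eq_preimage_graphCross D D' K z r₁ r₂ δ hδ hD'D]
  have himg : (fun x : ℂ => (δ : ℂ) * x) '' D' = (fun x : ℂ => (δ : ℂ)⁻¹ * x) ⁻¹' D' := by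
    ext x
    simp only [mem_image, mem_preimage]
    constructor
    · rintro ⟨y, hy, rfl⟩
      rwa [inv_mul_cancel_left₀ hδ0]
    · intro hx
      exact ⟨(δ : ℂ)⁻¹ * x, hx, mul_inv_cancel_left₀ hδ0 x⟩
  have hKD : MeasurableSet (K ∩ (fun x : ℂ => (δ : ℂ) * x) '' D') := by
    rw [himg]
    exact hK.inter (hD'.preimage (measurable_id.const_mul _))
  refine (measurableSet_graphCross _ _ _ δ hKD measurableSet_closedBall measurableSet_ball.compl
    hδ).preimage ?_
  exact ((PointConfig.measurable_restrict hD).comp measurable_fst).prodMk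
    ((PointConfig.measurable_restrict hD).comp measurable_snd)

/-! ### The one-arm bound -/

/-- **Deterministic core of the bound**: a localised chain arm whose black nuclei leave no
`ℓ/2`-void over `cthickening (2ℓ) D'` (`cthickening (3ℓ) D' ⊆ D`) and whose white configuration
is non-empty carries a path inside `blackRegion c.1 c.2` from a point within `r₁` of `z` to a
point at distance `≥ r₂` from `z` (the landed `chain_blackPath`). [folklore] -/
theorem al_chainArm_blackPath {D D' K : Set ℂ} {z : ℂ} {r₁ r₂ ℓ δ : ℝ} (hℓ : 0 < ℓ)
    (hD : cthickening (3 * ℓ) D' ⊆ D) {c : PointConfig ℂ × PointConfig ℂ}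
    (hc : ChainArm (adjEuc D c) z r₁ r₂ K δ ((c.1 : Set ℂ) ∩ D'))
    (hV : ∀ x ∈ cthickening (2 * ℓ) D', ∃ y ∈ (c.1 : Set ℂ), dist y x < ℓ / 2)
    (hW : (c.2 : Set ℂ).Nonempty) :
    ∃ (a b : ℂ) (γ : Path a b), dist a z ≤ r₁ ∧ r₂ ≤ dist b z ∧
      ∀ t, (γ t : ℂ) ∈ blackRegion (c.1 : Set ℂ) (c.2 : Set ℂ) := by
  obtain ⟨N, p, hp, -, h0, hN, hE⟩ := hc
  obtain ⟨⟨γ, hγ⟩, -⟩ := chain_blackPath ((c.1 : Set ℂ) ∩ D) ((c.2 : Set ℂ) ∩ D) (c.1 : Set ℂ)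
    (c.2 : Set ℂ) (cthickening (2 * ℓ) D') ℓ N p hℓ inter_subset_left hW
    (fun i => ⟨(hp i).1, hD (self_subset_cthickening D' (hp i).2)⟩) hE
    (fun i => closedBall_subset_cthickening (hp i).2 (2 * ℓ))
    (fun x hx => by
      obtain ⟨y, hy, hyx⟩ := hV x hx
      refine ⟨y, Or.inl ⟨hy, hD (al_mem_cthickening_three hℓ.le hx ?_)⟩, by rwa [dist_comm]⟩
      linarith)
    (fun x hx y hy hyN => lt_of_not_ge fun hxy =>
      hyN ⟨hy, hD (al_mem_cthickening_three hℓ.le hx (by rwa [dist_comm]))⟩)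
  exact ⟨p 0, p (Fin.last N), γ, h0, hN, hγ⟩

/-- **One-arm bound for the localised chain-arm event** (GIVEN Tassion's annealed one-arm bound
`VoronoiAnnealedOneArm`): there are `C ≥ 0`, `η > 0` such that for `0 < δ`, `0 < ℓ`,
`1 ≤ r₁ ≤ r₂` and `cthickening (3ℓ) D' ⊆ D`, the `lawBW volume`-probability of an
`adjEuc D`-chain arm around `z` between radii `r₁`, `r₂` with black nuclei in `D'` is at most
`C (r₁/r₂)^η` plus the probability of an `ℓ/2`-void of black nuclei over `cthickening (2ℓ) D'`.
Off the void event (and the null event of an empty white configuration) the chain is a black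
path (`al_chainArm_blackPath`), i.e. Tassion's event at mesh `1` for `PB = PW = poissonLaw volume`.
[folklore] -/
theorem armLoc_bound : Literature.Probability.Percolation.VoronoiAnnealedOneArm → ∃ C η : ℝ, 0 < η ∧ 0 ≤ C ∧ ∀ (D D' K : Set ℂ) (z : ℂ) (r₁ r₂ ℓ δ : ℝ), 0 < δ → 0 < ℓ → 1 ≤ r₁ → r₁ ≤ r₂ → Metric.cthickening (3 * ℓ) D' ⊆ D → (lawBW (MeasureTheory.volume : MeasureTheory.Measure ℂ)).real {c | ChainArm (adjEuc D c) z r₁ r₂ K δ ((c.1 : Set ℂ) ∩ D')} ≤ C * (r₁ / r₂) ^ η + (lawBW (MeasureTheory.volume : MeasureTheory.Measure ℂ)).real {c | ∃ x ∈ Metric.cthickening (2 * ℓ) D', ∀ y ∈ (c.1 : Set ℂ), ℓ / 2 ≤ dist y x} := by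
  intro hF1
  obtain ⟨C₀, η, hη, hbound⟩ := hF1 (poissonLaw volume) (poissonLaw volume)
    isPoissonPointProcess_poissonLaw_volume isPoissonPointProcess_poissonLaw_volume
  refine ⟨max C₀ 0, η, hη, le_max_right _ _, ?_⟩
  intro D D' K z r₁ r₂ ℓ δ _hδ hℓ hr₁ hr₁₂ hD
  haveI := isProbabilityMeasure_lawBW_volume
  have hr : (0 : ℝ) ≤ r₁ / r₂ := div_nonneg (by linarith) (by linarith)
  refine al_measureReal_le_of_subset_union₃ ?_ al_lawBW_real_snd_not_nonempty
    ((hbound 1 r₁ r₂ one_pos hr₁ hr₁₂ z).trans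
      (mul_le_mul_of_nonneg_right (le_max_left C₀ 0) (Real.rpow_nonneg hr η)))
  -- the arm event is contained in Tassion's event ∪ the void event ∪ {no white nucleus}
  intro c hc
  by_cases hW : (c.2 : Set ℂ).Nonempty
  swap
  · exact Or.inr hW
  by_cases hV : ∃ x ∈ cthickening (2 * ℓ) D', ∀ y ∈ (c.1 : Set ℂ), ℓ / 2 ≤ dist y x
  · exact Or.inl (Or.inr hV)
  push Not at hV
  obtain ⟨a, b, γ, ha, hb, hγ⟩ := al_chainArm_blackPath hℓ hD hc hV hW
  refine Or.inl (Or.inl ⟨a, b, γ, ha, hb, fun t => ?_⟩)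
  simpa only [Complex.ofReal_one, div_one] using hγ t

end Summit.CriticalPhenomena.CardyFormulaZ2.Cruxes.VoronoiHubFromSmirnov.MoebiusExactDelaunayDilationWard

end
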